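import Mathlib

/-!
# Crux `BinomialElusive.BinomialCandidate` (stmt-ValiantsHypothesis-7392), line `registered` —
# stub `stub_crossCap`, piece 4: the corank-one normal form of the Jacobian (linear algebra)

Let `J` be an `(n₀+2) × (n₀+1)` complex matrix whose kernel is the line spanned by `κ ≠ 0`
(corank one).  `crossCap_linearAlgebra`: there are invertible matrices `P` (target) and `S`
(source) such that the first column of `S` is `κ` and `P J S = E`, where `E` has entries
`E_{l+2, l+1} = 1` (`l < n₀`) and `0` elsewhere: in the new coordinates the differential kills
the first source direction and maps the `(l+1)`-st source direction to the `(l+2)`-nd target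
direction, the target directions `0, 1` being complementary to the image.

Construction: `S = (κ | e_{σ(1)} | … | e_{σ(n₀)})` with `σ` enumerating the indices other than a
fixed `j₀` with `κ_{j₀} ≠ 0`; the columns `c_l := J S e_{l+1}` are independent, and `P` has rows
`(r₀, r₁, L_1, …, L_{n₀})` with `L` a left inverse of `(c_l)_l` and `(r₀, r₁)` a basis of the
left annihilator of the `c_l` (rank–nullity).  Mathlib only.
-/

-- layout Summits/ValiantsHypothesis/ValiantsHypothesis forces the duplicated namespace component
set_option linter.dupNamespace false

noncomputable section

namespace Summit.ValiantsHypothesis.ValiantsHypothesis.Theorems.BinomialCandidateStubs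

open scoped BigOperators

namespace CrossCap

variable {n₀ : ℕ}

/-- A source basis whose first vector is `κ ≠ 0`: an invertible `S` with first column `κ`. -/
theorem exists_source_matrix (κ : Fin (n₀ + 1) → ℂ) (hκ : κ ≠ 0) :
    ∃ S S' : Matrix (Fin (n₀ + 1)) (Fin (n₀ + 1)) ℂ, S * S' = 1 ∧ S' * S = 1 ∧ ∀ l, S l 0 = κ l := by
  classical
  obtain ⟨j₀, hj₀⟩ := Function.ne_iff.mp hκ
  let S : Matrix (Fin (n₀ + 1)) (Fin (n₀ + 1)) ℂ :=
    Matrix.of fun l => Fin.cons (κ l) (fun j' : Fin n₀ => if l = j₀.succAbove j' then (1 : ℂ) else 0)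
  have hS0 : ∀ l, S l 0 = κ l := fun l => by simp [S]
  have hSsucc : ∀ l (j' : Fin n₀), S l j'.succ = if l = j₀.succAbove j' then 1 else 0 := fun l j' => by
    simp [S]
  have hmul : ∀ (u : Fin (n₀ + 1) → ℂ) (l : Fin (n₀ + 1)),
      S.mulVec u l = κ l * u 0 + ∑ j' : Fin n₀, (if l = j₀.succAbove j' then 1 else 0) * u j'.succ := by
    intro u l
    simp only [Matrix.mulVec, dotProduct, Fin.sum_univ_succ, hS0, hSsucc]
  have key : ∀ u : Fin (n₀ + 1) → ℂ, S.mulVec u = 0 → u = 0 := by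
    intro u hu
    have hu0 : u 0 = 0 := by
      have := congrFun hu j₀
      rw [hmul, Pi.zero_apply, Finset.sum_eq_zero (fun j' _ => by
        rw [if_neg (Fin.succAbove_ne j₀ j').symm, zero_mul]), add_zero] at this
      exact (mul_eq_zero.mp this).resolve_left hj₀
    funext j
    refine Fin.cases hu0 (fun j' => ?_) j
    have := congrFun hu (j₀.succAbove j')
    rw [hmul, Pi.zero_apply, hu0, mul_zero, zero_add] at this
    rw [Finset.sum_eq_single j'] at this
    · simpa using this
    · intro l' _ hl'
      rw [if_neg (fun h => hl' (Fin.succAbove_right_inj.mp h).symm), zero_mul]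
    · simp
  have hSinj : Function.Injective S.mulVec := by
    intro v w hvw
    have : S.mulVec (v - w) = 0 := by rw [Matrix.mulVec_sub, hvw, sub_self]
    exact sub_eq_zero.mp (key _ this)
  have hSunit : IsUnit S := Matrix.mulVec_injective_iff_isUnit.mp hSinj
  rw [Matrix.isUnit_iff_isUnit_det] at hSunit
  exact ⟨S, S⁻¹, Matrix.mul_nonsing_inv S hSunit, Matrix.nonsing_inv_mul S hSunit, hS0⟩

/-- Completing `n₀` independent columns `c_l ∈ ℂ^{n₀+2}` to a target basis: an invertible `P`
with `P c_l = e_{l+2}` (rows: a basis of the left annihilator, then a left inverse). -/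
theorem exists_target_matrix (C : Matrix (Fin (n₀ + 2)) (Fin n₀) ℂ)
    (hC : Function.Injective C.mulVec) :
    ∃ P P' : Matrix (Fin (n₀ + 2)) (Fin (n₀ + 2)) ℂ, P * P' = 1 ∧ P' * P = 1 ∧
      ∀ (i : Fin (n₀ + 2)) (l' : Fin n₀), (P * C) i l' = if i = l'.succ.succ then 1 else 0 := by
  classical
  -- a left inverse
  have hC' : Function.Injective C.mulVecLin := fun v w h => hC (by simpa using h)
  obtain ⟨g, hg⟩ := LinearMap.exists_leftInverse_of_injective C.mulVecLin
    (LinearMap.ker_eq_bot.mpr hC')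
  let L : Matrix (Fin n₀) (Fin (n₀ + 2)) ℂ := LinearMap.toMatrix' g
  have hL : ∀ j' l' : Fin n₀, ∑ i', L j' i' * C i' l' = if j' = l' then 1 else 0 := by
    intro j' l'
    have h1 : L.mulVec (C.mulVec (Pi.single l' 1)) = Pi.single l' 1 := by
      have := congrArg (fun φ => φ (Pi.single l' 1)) hg
      simpa [L, LinearMap.toMatrix'_mulVec] using this
    have := congrFun h1 j'
    simp only [Matrix.mulVec, dotProduct, Pi.single_apply, mul_ite, mul_one, mul_zero,
      Finset.sum_ite_eq', Finset.mem_univ, if_true] at this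
    exact this
  -- the left annihilator has dimension two
  let N : Submodule ℂ (Fin (n₀ + 2) → ℂ) := LinearMap.ker C.transpose.mulVecLin
  have hN : ∀ r ∈ N, ∀ l', ∑ i', r i' * C i' l' = 0 := by
    intro r hr l'
    have := congrFun (LinearMap.mem_ker.mp hr) l'
    simp only [Matrix.mulVecLin_apply, Matrix.mulVec, dotProduct, Matrix.transpose_apply,
      Pi.zero_apply] at this
    simpa [mul_comm] using this
  have hfin : Module.finrank ℂ N = 2 := by
    have h1 := LinearMap.finrank_range_add_finrank_ker C.transpose.mulVecLin
    have h2 : Module.finrank ℂ (LinearMap.range C.transpose.mulVecLin) = n₀ := by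
      change C.transpose.rank = n₀
      rw [Matrix.rank_transpose]
      change Module.finrank ℂ (LinearMap.range C.mulVecLin) = n₀
      rw [LinearMap.finrank_range_of_inj hC', Module.finrank_fin_fun]
    rw [h2, Module.finrank_fin_fun] at h1
    change n₀ + Module.finrank ℂ N = n₀ + 2 at h1
    omega
  let bN := Module.finBasisOfFinrankEq ℂ N hfin
  let r₀ : Fin (n₀ + 2) → ℂ := (bN 0 : N)
  let r₁ : Fin (n₀ + 2) → ℂ := (bN 1 : N)
  let P : Matrix (Fin (n₀ + 2)) (Fin (n₀ + 2)) ℂ := Matrix.of (Fin.cons r₀ (Fin.cons r₁ fun j' => L j'))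
  have hP0 : P 0 = r₀ := funext fun j => by simp [P, Matrix.of_apply]
  have hP1 : P 1 = r₁ := funext fun j => by
    rw [← Fin.succ_zero_eq_one]; simp [P, Matrix.of_apply]
  have hPss : ∀ j', P j'.succ.succ = L j' := fun j' => funext fun j => by
    simp [P, Matrix.of_apply]
  have hPC : ∀ (i : Fin (n₀ + 2)) (l' : Fin n₀),
      ∑ i', P i i' * C i' l' = if i = l'.succ.succ then 1 else 0 := by
    intro i l'
    refine Fin.cases ?_ (fun i₁ => ?_) i
    · rw [hP0, hN r₀ (bN 0).2, if_neg (Fin.succ_ne_zero _).symm]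
    · refine Fin.cases ?_ (fun j' => ?_) i₁
      · rw [Fin.succ_zero_eq_one, hP1, hN r₁ (bN 1).2, if_neg]
        rw [← Fin.succ_zero_eq_one, Fin.succ_inj]
        exact (Fin.succ_ne_zero _).symm
      · rw [hPss, hL]
        by_cases h : j' = l'
        · subst h; simp
        · rw [if_neg h, if_neg (fun h' => h (Fin.succ_injective _ (Fin.succ_injective _ h')))]
  -- the rows of `P` are independent
  have hPli : LinearIndependent ℂ (fun i => P i) := by
    rw [Fintype.linearIndependent_iff]
    intro a ha
    have hsucc : ∀ l' : Fin n₀, a l'.succ.succ = 0 := by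
      intro l'
      have := congrArg (fun r : Fin (n₀ + 2) → ℂ => ∑ i', r i' * C i' l') ha
      simp only [Finset.sum_apply, Pi.smul_apply, smul_eq_mul, Finset.sum_mul, Pi.zero_apply,
        zero_mul, Finset.sum_const_zero] at this
      rw [Finset.sum_comm] at this
      simp only [mul_assoc, ← Finset.mul_sum, hPC, mul_ite, mul_one, mul_zero,
        Finset.sum_ite_eq', Finset.mem_univ, if_true] at this
      exact this
    have h01 : a 0 • r₀ + a 1 • r₁ = 0 := by
      rw [Fin.sum_univ_succ, Fin.sum_univ_succ, hP0, Fin.succ_zero_eq_one, hP1,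
        Finset.sum_eq_zero (fun j' _ => by rw [hsucc, zero_smul]), add_zero] at ha
      exact ha
    have hb := bN.linearIndependent
    rw [Fintype.linearIndependent_iff] at hb
    have hb' := hb ![a 0, a 1] (by
      apply Subtype.ext
      rw [Fin.sum_univ_two]
      simpa [r₀, r₁] using h01)
    intro i
    refine Fin.cases ?_ (fun i₁ => ?_) i
    · simpa using hb' 0
    · refine Fin.cases ?_ (fun j' => ?_) i₁
      · simpa using hb' 1
      · exact hsucc j'
  have hPunit : IsUnit P := Matrix.linearIndependent_rows_iff_isUnit.mp hPli
  rw [Matrix.isUnit_iff_isUnit_det] at hPunit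
  refine ⟨P, P⁻¹, Matrix.mul_nonsing_inv P hPunit, Matrix.nonsing_inv_mul P hPunit, fun i l' => ?_⟩
  rw [Matrix.mul_apply]
  exact hPC i l'

end CrossCap

open CrossCap in
/-- **Corank-one normal form of the Jacobian** (piece 4 of the stub `stub_crossCap`): for an
`(n₀+2) × (n₀+1)` matrix `J` with kernel the line `ℂ κ`, there are invertible `P`, `S` with
`S e_0 = κ` and `P J S = E`, `E_{l+2,l+1} = 1` and all other entries `0`. -/
theorem crossCap_linearAlgebra :
    ∀ (n₀ : ℕ) (J : Matrix (Fin (n₀ + 2)) (Fin (n₀ + 1)) ℂ) (κ : Fin (n₀ + 1) → ℂ),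
      κ ≠ 0 → J.mulVec κ = 0 →
      (∀ κ' : Fin (n₀ + 1) → ℂ, J.mulVec κ' = 0 → ∃ μ : ℂ, κ' = μ • κ) →
      ∃ (P P' : Matrix (Fin (n₀ + 2)) (Fin (n₀ + 2)) ℂ) (S S' : Matrix (Fin (n₀ + 1)) (Fin (n₀ + 1)) ℂ),
        P * P' = 1 ∧ P' * P = 1 ∧ S * S' = 1 ∧ S' * S = 1 ∧ (∀ l, S l 0 = κ l) ∧
        (∀ i, (P * J * S) i 0 = 0) ∧
        ∀ i (l' : Fin n₀), (P * J * S) i l'.succ = if i = l'.succ.succ then 1 else 0 := by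
  intro n₀ J κ hκ hJκ hcorank
  classical
  obtain ⟨S, S', hSS', hS'S, hS0⟩ := exists_source_matrix κ hκ
  -- the regular columns of `J S`
  let C : Matrix (Fin (n₀ + 2)) (Fin n₀) ℂ := Matrix.of fun i l' => (J * S) i l'.succ
  have hcol0 : ∀ i, (J * S) i 0 = 0 := by
    intro i
    have := congrFun hJκ i
    rw [Matrix.mul_apply]
    simpa [Matrix.mulVec, dotProduct, hS0] using this
  have hCmul : ∀ u : Fin n₀ → ℂ, C.mulVec u = (J * S).mulVec (Fin.cons 0 u) := by
    intro u
    funext i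
    simp [C, Matrix.mulVec, dotProduct, Fin.sum_univ_succ]
  have hC : Function.Injective C.mulVec := by
    have key : ∀ u : Fin n₀ → ℂ, C.mulVec u = 0 → u = 0 := by
      intro u hu
      rw [hCmul, ← Matrix.mulVec_mulVec] at hu
      obtain ⟨μ, hμ⟩ := hcorank _ hu
      have hSe : S.mulVec (Pi.single 0 1) = κ := by
        rw [Matrix.mulVec_single_one]
        funext l
        exact hS0 l
      have h2 : S.mulVec (Fin.cons 0 u - μ • Pi.single 0 1) = 0 := by
        rw [Matrix.mulVec_sub, Matrix.mulVec_smul, hSe, hμ, sub_self]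
      have h3 : Fin.cons 0 u - μ • (Pi.single 0 1 : Fin (n₀ + 1) → ℂ) = 0 := by
        have := congrArg S'.mulVec h2
        rwa [Matrix.mulVec_mulVec, hS'S, Matrix.one_mulVec, Matrix.mulVec_zero] at this
      funext l'
      have := congrFun h3 l'.succ
      simpa [Pi.single_apply, Fin.succ_ne_zero] using this
    intro v w hvw
    have : C.mulVec (v - w) = 0 := by rw [Matrix.mulVec_sub, hvw, sub_self]
    exact sub_eq_zero.mp (key _ this)
  obtain ⟨P, P', hPP', hP'P, hPC⟩ := exists_target_matrix C hC
  refine ⟨P, P', S, S', hPP', hP'P, hSS', hS'S, hS0, fun i => ?_, fun i l' => ?_⟩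
  · rw [Matrix.mul_assoc, Matrix.mul_apply]
    simp [hcol0]
  · rw [Matrix.mul_assoc, Matrix.mul_apply, ← hPC i l']
    rfl

end Summit.ValiantsHypothesis.ValiantsHypothesis.Theorems.BinomialCandidateStubs

end
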